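import Summits.QuantumFields.BalabanUV.T4Continuum.Support.ShellMeasurePinnedNorm
import Summits.QuantumFields.BalabanUV.T4Continuum.Support.ShellMeasureDecayKernelTail

/-!
# `T4Continuum.ShellMeasureGradientPinnedLocal` — row S70 companion GP (file 1∕2) of the LOCALITY ROAD: THE (P4) LETTER
# IS PINNED-LIPSCHITZ BY LOCALITY — finite-range kernels between PINNED spaces, the pinned mean-value inequality for
# maps between bond-field spaces of two index types, and the HESSIAN ENTRIES of one local plaquette functional
(cell `pub-balaban`, sub-cell `t4`, spine estimate NE7c (node U5b); NE7c ROUND-2 crew, unit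
`b2b-balaban-t4-ne7c-formalise-leaf-06` gen 5, owner table `t4/b2b-balaban-t4-ne7c-p1/LEAVES-NE7c-P1.md` row S70
«END-II-loc: the LD chain in two norms» (holder leaf-01-g6; companions by file: f2 leaf-07-g6, `DCf` leaf-08-g12, GP this
unit — journal «OFFER∕CLAIM S70 companion GP»); imports the owner's S69 `ShellMeasurePinnedNorm` (p223286: `pinW`,
`kerOpPin`) and this lineage's S66 f3c `ShellMeasureDecayKernelTail` (p223071: `dker`, `kerOp_dker`; hence S62 f1
`ShellMeasureLocalGradientTail`: `sgl`, `locGrad`, `tail₂`) ONLY; [folklore]; 0 `def`, 0 `def … : Prop`, 0 sorry,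
0 citations)

HONEST FRAMING.  Finite four-torus programme, rung (B)+1 only — NOT infinite volume, NOT a mass gap, NOT the Clay
problem, NOT summit progress; (B), `BetaPertHyp`, (B^μ) are not consumed.  NE7c (`T4IndicatorShell.ShellWeightBound`)
is NOT PRINTED in [Balaban 1983–89] and NOT PROVED; «NE7c ⇐ the named binders» (trigger c3, WALL §2).  Elementary
calculus (Cauchy estimates, the mean-value inequality) and finite sums on OUR side; nothing printed is asserted or cited
as a fact; no estimate of Bałaban's at a live level is discharged; NOTHING in the countdown moves.  HONEST DEPENDENCY
(cell): continuum YM on T⁴ ⇐ BetaPertH ∧ nine spine estimates (0/9 proved); BetaPertH ⇐ (D1) ∧ (D4) ∧ CAP+tail;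
G-an2-4 gates asym, D1 and NE2/3/4.

THE POINT (owner finding F-ne7cp1-g30-1, GAPS l.25103; row S70 (ii)).  The locality road re-reads the VARIATION of
the LD chain's exponent field in S69's PINNED norm `WSup (pinW δ′ ϖ) 1` (`‖A‖_pin = sup_b e^{δ′ϖ(b)}‖A b‖`).  Row S70
(ii) lists «`𝒢 ∘ D(W𝒱)` as `kerOp`∕`kerOpPin` of kernels with DISPLAYED decay binders», and the companion f2
(leaf-07-g6, (F2)) takes the pinned contraction number `q_W` of `Y ↦ 𝒢 (W Y)` as a BINDER.  THIS PAIR OF FILES SPLITS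
THAT BINDER: the propagator `𝒢` keeps its displayed decay ((3.133)∕[5] Thm 3.13 TYPE ⟹ S69 (A), row S70 f1), but the
(P4) letter itself — END-II's nonlinearity `W = tail₂ (locGrad V)` for an action `V = Σ_p φ_p` of LOCAL plaquette
functionals, analytic and bounded on the flat ball (exactly the data of S62 f1 `prop4Hyp_locGrad`; nothing new is
displayed) — is pinned-Lipschitz ON OUR SIDE with a VOLUME-FREE constant, because its derivative kernel, the HESSIAN
of the action, VANISHES unless the two bonds lie in a common plaquette support (finite range).  File 2∕2
`ShellMeasureGradientPinnedLocalEnd` assembles the END; this file carries the three generic ingredients: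
* §1 `norm_kerOpPin_apply_le_of_rowSum` ∕ `opNorm_kerOpPin_le_of_rowSum` (S69 (A) with the conjugated row sum as
  the hypothesis) and **`pinnedRowSum_le_of_finiteRange`** ∕ **`opNorm_kerOpPin_le_of_finiteRange`**: a kernel
  vanishing off a range `N c` on which the pin grows by at most `r₀` (`ϖo c ≤ ϖi b + r₀`), with flat range row sums
  `Σ_{b ∈ N c} ‖k c b‖ ≤ θ`, is bounded pinned→pinned by `θ·e^{δ′r₀}` — for EVERY rate `δ′ ≥ 0`, no reduced-rate sums,
  no metric (S69 (A)'s finite-range sibling).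
* §2 `hasFDerivAt_conj`, **`norm_sub_pin_le_of_kerOpPin_le`**: the pinned mean-value inequality for ANY
  `D : (Λ → 𝔄) → (Λ′ → 𝔅)` differentiable on the flat ball with `‖kerOpPin (dker D A) δ′ ϖi ϖo‖ ≤ L` there — two index
  types, two fibres, two pin profiles (leaf-08-g12's `ShellMeasureLandauDerivativeDecayPinned.norm_sub_pin_le_of_
  entry_decay` is the `Λ′ = Λ`, `𝔅 = 𝔄`, decaying-kernel instance of the same step — not imported, not restated).
* §3 ONE PLAQUETTE (`φ_p` analytic with `‖φ_p‖ ≤ M₀` on the flat `ball 0 R`, LOCAL to `S = supp p`): the vector-valued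
  one-bond Cauchy estimate at a general radius (`norm_fderiv_comp_sgl_le_of_lt`), «bounded ⇒ Lipschitz on a smaller
  ball» (`norm_sub_le_of_ball_bound`), LOCALITY OF DERIVATIVES (`fderiv_add_single_of_local`,
  `fderiv_comp_sgl_eq_zero_of_local` — vector-valued, no differentiability proviso), and the HESSIAN ENTRIES
  `h_{c,b}(A) = D[Dφ_p(·)∘ι_c](A)∘ι_b ∈ (𝔄 →L (𝔄 →L ℂ))`: zero for `b ∉ S` (`hessEntry_eq_zero_of_not_mem`),
  `‖h_{c,b}‖ ≤ 16M₀∕R²` on `ball 0 (R∕2)` (`norm_hessEntry_le`), `(64M₀∕R³)`-Lipschitz on `ball 0 (R∕4)`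
  (`norm_hessEntry_sub_le`) — Cauchy three times (`B8SectDSource.norm_fderiv_le_of_norm_le`).
TECHNICAL NOTE (for readers running mutants): algebraic lemmas on the Hessian type `𝔄 →L[ℂ] (𝔄 →L[ℂ] ℂ)` are applied
with the carrier given EXPLICITLY (`sub_self (0 : …)`, `norm_zero (E := …)`, `norm_sum_le (E := …)`) — with the
carrier left implicit the unifier unfolds `fderiv`∕operator-algebra instances and times out.
NOT HERE: the Hessian kernel of the sum and the END (file 2∕2); the multi-grid weighted twin (S65 f2b currency); the
`HD`-dressing and `∇`-part of (80)∕(98); `𝒢`'s decay; [dict] — displayed or elsewhere.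
-/

noncomputable section

open Metric Set Function Filter
open scoped Topology

namespace Summit.QuantumFields.BalabanUV.T4Continuum.ShellMeasureGradientPinnedLocal

open Literature.MathematicalPhysics.QuantumFieldTheory.Balaban1983to89
open B8SectDSource (norm_fderiv_le_of_norm_le)
open Summit.QuantumFields.BalabanUV.T4Continuum.ShellMeasureMultiGridNorms (WSup)
open Summit.QuantumFields.BalabanUV.T4Continuum.ShellMeasurePinnedNorm
  (pinW pinW_apply kerOpPin kerOpPin_apply norm_apply_le_exp_neg)
open Summit.QuantumFields.BalabanUV.T4Continuum.ShellMeasureDecayKernelSums (kerOp kerOp_apply)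
open Summit.QuantumFields.BalabanUV.T4Continuum.ShellMeasureDecayKernelTail (dker dker_apply kerOp_dker)
open Summit.QuantumFields.BalabanUV.T4Continuum.ShellMeasureLocalGradientTail
  (sgl sgl_apply norm_sgl_le locGrad locGrad_apply locGrad_sum_eq_filter tail₂ tail₂_apply differentiableOn_locGrad
    analyticOnNhd_sum)

variable {Λ Λ' : Type*} [Fintype Λ] [Fintype Λ'] {𝔄 𝔅 F : Type*} [NormedAddCommGroup 𝔄] [NormedSpace ℂ 𝔄]
  [NormedAddCommGroup 𝔅] [NormedSpace ℂ 𝔅] [NormedAddCommGroup F] [NormedSpace ℂ F]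

/-! ## §1 Pinned operator bounds from conjugated row sums; finite-range kernels -/

section RowSum

/-- **CONJUGATED ROW SUMS BOUND THE PINNED OPERATOR** (S69 (A) with the row sum itself as the hypothesis):
`Σ_b e^{δ′ϖo(c)}·‖k c b‖·e^{−δ′ϖi(b)} ≤ Θ` for every `c` ⟹ `‖kerOpPin k δ′ ϖi ϖo A‖_pin ≤ Θ·‖A‖_pin`. [folklore] -/
theorem norm_kerOpPin_apply_le_of_rowSum (k : Λ' → Λ → (𝔄 →L[ℂ] 𝔅)) (δ' : ℝ) (ϖi : Λ → ℝ) (ϖo : Λ' → ℝ)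
    {Θ : ℝ} (hΘ : 0 ≤ Θ)
    (hrow : ∀ c, ∑ b, Real.exp (δ' * ϖo c) * ‖k c b‖ * Real.exp (-(δ' * ϖi b)) ≤ Θ)
    (A : WSup (pinW δ' ϖi) 1 𝔄) : ‖kerOpPin k δ' ϖi ϖo A‖ ≤ Θ * ‖A‖ := by
  refine (WSup.norm_le_iff (pinW δ' ϖo) 1 (by positivity)).2 fun c => ?_
  rw [pow_one, pinW_apply, kerOpPin_apply]
  have hcomp : ∀ b, ‖A b‖ ≤ Real.exp (-(δ' * ϖi b)) * ‖A‖ := fun b => norm_apply_le_exp_neg δ' ϖi A b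
  calc Real.exp (δ' * ϖo c) * ‖∑ b, k c b (A b)‖
      ≤ Real.exp (δ' * ϖo c) * ∑ b, ‖k c b‖ * (Real.exp (-(δ' * ϖi b)) * ‖A‖) := by
        refine mul_le_mul_of_nonneg_left ((norm_sum_le _ _).trans (Finset.sum_le_sum fun b _ => ?_))
          (Real.exp_pos _).le
        exact ((k c b).le_opNorm _).trans (mul_le_mul_of_nonneg_left (hcomp b) (norm_nonneg _))
    _ = (∑ b, Real.exp (δ' * ϖo c) * ‖k c b‖ * Real.exp (-(δ' * ϖi b))) * ‖A‖ := by
        rw [Finset.mul_sum, Finset.sum_mul]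
        exact Finset.sum_congr rfl fun b _ => by ring
    _ ≤ Θ * ‖A‖ := mul_le_mul_of_nonneg_right (hrow c) (norm_nonneg _)

/-- … hence the operator norm `‖kerOpPin k δ′ ϖi ϖo‖ ≤ Θ`. [folklore] -/
theorem opNorm_kerOpPin_le_of_rowSum (k : Λ' → Λ → (𝔄 →L[ℂ] 𝔅)) (δ' : ℝ) (ϖi : Λ → ℝ) (ϖo : Λ' → ℝ)
    {Θ : ℝ} (hΘ : 0 ≤ Θ)
    (hrow : ∀ c, ∑ b, Real.exp (δ' * ϖo c) * ‖k c b‖ * Real.exp (-(δ' * ϖi b)) ≤ Θ) :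
    ‖kerOpPin k δ' ϖi ϖo‖ ≤ Θ :=
  ContinuousLinearMap.opNorm_le_bound _ hΘ (norm_kerOpPin_apply_le_of_rowSum k δ' ϖi ϖo hΘ hrow)

omit [Fintype Λ'] in
/-- **FINITE RANGE COSTS ONLY `e^{δ′·range}`.**  A kernel vanishing off a range `N c`, on which the pin grows by at most
`r₀` (`ϖo c ≤ ϖi b + r₀` for `b ∈ N c`), with flat range row sums `Σ_{b ∈ N c} ‖k c b‖ ≤ θ` and `0 ≤ δ′`, has conjugated
row sums `≤ θ·e^{δ′r₀}` — for EVERY rate `δ′`, no reduced-rate exponential sums, no metric. [folklore] -/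
theorem pinnedRowSum_le_of_finiteRange (k : Λ' → Λ → (𝔄 →L[ℂ] 𝔅)) (N : Λ' → Finset Λ) (ϖi : Λ → ℝ)
    (ϖo : Λ' → ℝ) {δ' r₀ θ : ℝ} (hδ' : 0 ≤ δ') (hzero : ∀ c, ∀ b ∉ N c, k c b = 0)
    (hϖ : ∀ c, ∀ b ∈ N c, ϖo c ≤ ϖi b + r₀) (hθ : ∀ c, ∑ b ∈ N c, ‖k c b‖ ≤ θ) (c : Λ') :
    ∑ b, Real.exp (δ' * ϖo c) * ‖k c b‖ * Real.exp (-(δ' * ϖi b)) ≤ θ * Real.exp (δ' * r₀) := by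
  rw [← Finset.sum_subset (Finset.subset_univ (N c)) fun b _ hb => by rw [hzero c b hb, norm_zero]; ring]
  calc ∑ b ∈ N c, Real.exp (δ' * ϖo c) * ‖k c b‖ * Real.exp (-(δ' * ϖi b))
      ≤ ∑ b ∈ N c, ‖k c b‖ * Real.exp (δ' * r₀) := Finset.sum_le_sum fun b hb => by
        have h1 : Real.exp (δ' * ϖo c) * Real.exp (-(δ' * ϖi b)) ≤ Real.exp (δ' * r₀) := by
          rw [← Real.exp_add]
          exact Real.exp_le_exp.2 (by nlinarith [hϖ c b hb])
        calc Real.exp (δ' * ϖo c) * ‖k c b‖ * Real.exp (-(δ' * ϖi b))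
            = ‖k c b‖ * (Real.exp (δ' * ϖo c) * Real.exp (-(δ' * ϖi b))) := by ring
          _ ≤ ‖k c b‖ * Real.exp (δ' * r₀) := mul_le_mul_of_nonneg_left h1 (norm_nonneg _)
    _ = (∑ b ∈ N c, ‖k c b‖) * Real.exp (δ' * r₀) := by rw [Finset.sum_mul]
    _ ≤ θ * Real.exp (δ' * r₀) := mul_le_mul_of_nonneg_right (hθ c) (Real.exp_pos _).le

/-- **FINITE-RANGE KERNEL ⇒ PINNED OPERATOR BOUND `θ·e^{δ′r₀}`** (S69 (A)'s finite-range sibling). [folklore] -/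
theorem opNorm_kerOpPin_le_of_finiteRange (k : Λ' → Λ → (𝔄 →L[ℂ] 𝔅)) (N : Λ' → Finset Λ) (ϖi : Λ → ℝ)
    (ϖo : Λ' → ℝ) {δ' r₀ θ : ℝ} (hδ' : 0 ≤ δ') (hθ0 : 0 ≤ θ) (hzero : ∀ c, ∀ b ∉ N c, k c b = 0)
    (hϖ : ∀ c, ∀ b ∈ N c, ϖo c ≤ ϖi b + r₀) (hθ : ∀ c, ∑ b ∈ N c, ‖k c b‖ ≤ θ) :
    ‖kerOpPin k δ' ϖi ϖo‖ ≤ θ * Real.exp (δ' * r₀) :=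
  opNorm_kerOpPin_le_of_rowSum k δ' ϖi ϖo (by positivity)
    (pinnedRowSum_le_of_finiteRange k N ϖi ϖo hδ' hzero hϖ hθ)

end RowSum

/-! ## §2 The pinned mean-value inequality for a map between bond-field spaces of two index types -/

section MeanValue

variable [DecidableEq Λ] (δ' : ℝ) (ϖi : Λ → ℝ) (ϖo : Λ' → ℝ)

omit [Fintype Λ'] [DecidableEq Λ] in
/-- The flat ball read in pinned coordinates, `{Y : toPiL Y ∈ ball 0 r}`, is convex (preimage of a convex set under the
ℝ-linear identity). [folklore] -/
theorem convex_preimage_toPiL_ball (r : ℝ) :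
    Convex ℝ {Y : WSup (pinW δ' ϖi) 1 𝔄 | WSup.toPiL (pinW δ' ϖi) 1 Y ∈ ball (0 : Λ → 𝔄) r} :=
  (convex_ball (0 : Λ → 𝔄) r).linear_preimage
    (((WSup.toPiL (𝔄 := 𝔄) (pinW δ' ϖi) 1 : WSup (pinW δ' ϖi) 1 𝔄 →L[ℂ] (Λ → 𝔄)) :
      WSup (pinW δ' ϖi) 1 𝔄 →ₗ[ℂ] (Λ → 𝔄)).restrictScalars ℝ)

/-- **CHAIN RULE THROUGH THE IDENTITIES.**  If `D : (Λ → 𝔄) → (Λ′ → 𝔅)` has flat derivative `𝔇` at `toPiL Y`, then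
`Y ↦ toPiL⁻¹ (D (toPiL Y))` has derivative `toPiL⁻¹ ∘L 𝔇 ∘L toPiL` at `Y` between the pinned spaces; for `𝔇 = DD(A)` this
is `kerOpPin (dker D A) δ′ ϖi ϖo` (`kerOp (dker D A) = DD(A)`, S66 f3c). [folklore] -/
theorem hasFDerivAt_conj {D : (Λ → 𝔄) → (Λ' → 𝔅)} {Y : WSup (pinW δ' ϖi) 1 𝔄}
    (hD : DifferentiableAt ℂ D (WSup.toPiL (pinW δ' ϖi) 1 Y)) :
    HasFDerivAt
      (fun Y : WSup (pinW δ' ϖi) 1 𝔄 =>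
        ((WSup.toPiL (pinW δ' ϖo) 1).symm (D (WSup.toPiL (pinW δ' ϖi) 1 Y)) : WSup (pinW δ' ϖo) 1 𝔅))
      (kerOpPin (dker D (WSup.toPiL (pinW δ' ϖi) 1 Y)) δ' ϖi ϖo) Y := by
  have h := ((WSup.toPiL (𝔄 := 𝔅) (pinW δ' ϖo) 1).symm.hasFDerivAt).comp Y
    (hD.hasFDerivAt.comp Y ((WSup.toPiL (𝔄 := 𝔄) (pinW δ' ϖi) 1).hasFDerivAt))
  have hk : kerOpPin (dker D (WSup.toPiL (pinW δ' ϖi) 1 Y)) δ' ϖi ϖo =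
      ((WSup.toPiL (𝔄 := 𝔅) (pinW δ' ϖo) 1).symm : (Λ' → 𝔅) →L[ℂ] WSup (pinW δ' ϖo) 1 𝔅).comp
        ((fderiv ℂ D (WSup.toPiL (pinW δ' ϖi) 1 Y)).comp
          ((WSup.toPiL (𝔄 := 𝔄) (pinW δ' ϖi) 1) : WSup (pinW δ' ϖi) 1 𝔄 →L[ℂ] (Λ → 𝔄))) := by
    unfold kerOpPin
    rw [kerOp_dker]
  rw [hk]
  exact h

/-- **THE PINNED MEAN-VALUE INEQUALITY.**  `D : (Λ → 𝔄) → (Λ′ → 𝔅)` differentiable on the flat ball `ball 0 r` with the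
pinned derivative bound `‖kerOpPin (dker D A) δ′ ϖi ϖo‖ ≤ L` at every `A` of that ball ⟹ for all `A, A′` in the ball
`‖D A − D A′‖_pin ≤ L·‖A − A′‖_pin` (fields read through `toPiL⁻¹` in `WSup (pinW δ′ ϖo) 1 𝔅` ∕ `WSup (pinW δ′ ϖi) 1 𝔄`).
[folklore] -/
theorem norm_sub_pin_le_of_kerOpPin_le {D : (Λ → 𝔄) → (Λ' → 𝔅)} {r L : ℝ} (hD : DifferentiableOn ℂ D (ball 0 r))
    (hL : ∀ A ∈ ball (0 : Λ → 𝔄) r, ‖kerOpPin (dker D A) δ' ϖi ϖo‖ ≤ L)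
    {A A' : Λ → 𝔄} (hA : A ∈ ball (0 : Λ → 𝔄) r) (hA' : A' ∈ ball (0 : Λ → 𝔄) r) :
    ‖((WSup.toPiL (pinW δ' ϖo) 1).symm (D A) - (WSup.toPiL (pinW δ' ϖo) 1).symm (D A') :
        WSup (pinW δ' ϖo) 1 𝔅)‖ ≤
      L * ‖((WSup.toPiL (pinW δ' ϖi) 1).symm A - (WSup.toPiL (pinW δ' ϖi) 1).symm A' :
        WSup (pinW δ' ϖi) 1 𝔄)‖ := by
  set e := WSup.toPiL (𝔄 := 𝔄) (pinW δ' ϖi) 1 with he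
  set e' := WSup.toPiL (𝔄 := 𝔅) (pinW δ' ϖo) 1 with he'
  set s : Set (WSup (pinW δ' ϖi) 1 𝔄) := {Y | e Y ∈ ball (0 : Λ → 𝔄) r} with hs
  have hconv : Convex ℝ s := convex_preimage_toPiL_ball δ' ϖi r
  have hf : ∀ Y ∈ s, HasFDerivWithinAt (fun Y : WSup (pinW δ' ϖi) 1 𝔄 => (e'.symm (D (e Y)) : WSup _ 1 𝔅))
      (kerOpPin (dker D (e Y)) δ' ϖi ϖo) s Y := fun Y hY =>
    (hasFDerivAt_conj δ' ϖi ϖo (hD.differentiableAt (isOpen_ball.mem_nhds hY))).hasFDerivWithinAt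
  have hbound : ∀ Y ∈ s, ‖kerOpPin (dker D (e Y)) δ' ϖi ϖo‖ ≤ L := fun Y hY => hL (e Y) hY
  have hAs : e.symm A ∈ s := by
    show e (e.symm A) ∈ ball (0 : Λ → 𝔄) r
    rw [e.apply_symm_apply]; exact hA
  have hA's : e.symm A' ∈ s := by
    show e (e.symm A') ∈ ball (0 : Λ → 𝔄) r
    rw [e.apply_symm_apply]; exact hA'
  have key := hconv.norm_image_sub_le_of_norm_hasFDerivWithin_le hf hbound hA's hAs
  simpa using key

end MeanValue

/-! ## §3 One plaquette: Cauchy at a general radius, locality of derivatives, the Hessian entries -/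

section OnePlaquette

variable [DecidableEq Λ]

/-- **ONE-BOND CAUCHY AT A GENERAL RADIUS (vector-valued).**  `ψ` ℂ-differentiable on `ball 0 R` with `‖ψ‖ ≤ M` there
(`0 ≤ M`), `ρ < R` ⟹ on `ball 0 ρ`: `‖Dψ(A) ∘ ι_b‖ ≤ M∕(R − ρ)` (`B8SectDSource.norm_fderiv_le_of_norm_le`, `‖ι_b‖ ≤ 1`).
[folklore] -/
theorem norm_fderiv_comp_sgl_le_of_lt {ψ : (Λ → 𝔄) → F} {R M ρ : ℝ} (hM : 0 ≤ M) (hρR : ρ < R)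
    (hd : DifferentiableOn ℂ ψ (ball 0 R)) (hb : ∀ A ∈ ball (0 : Λ → 𝔄) R, ‖ψ A‖ ≤ M) (b : Λ)
    {A : Λ → 𝔄} (hA : A ∈ ball (0 : Λ → 𝔄) ρ) : ‖(fderiv ℂ ψ A).comp (sgl b)‖ ≤ M / (R - ρ) := by
  have hAρ : ‖A‖ < ρ := mem_ball_zero_iff.1 hA
  have h1 : ‖fderiv ℂ ψ A‖ ≤ M / (R - ‖A‖) := norm_fderiv_le_of_norm_le hd hb (hAρ.trans hρR)
  have h2 : M / (R - ‖A‖) ≤ M / (R - ρ) := div_le_div_of_nonneg_left hM (by linarith) (by linarith)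
  calc ‖(fderiv ℂ ψ A).comp (sgl b)‖ ≤ ‖fderiv ℂ ψ A‖ * ‖(sgl b : 𝔄 →L[ℂ] (Λ → 𝔄))‖ :=
      ContinuousLinearMap.opNorm_comp_le _ _
    _ ≤ M / (R - ρ) * 1 :=
        mul_le_mul (h1.trans h2) (norm_sgl_le b) (norm_nonneg _) (div_nonneg hM (by linarith))
    _ = M / (R - ρ) := mul_one _

omit [DecidableEq Λ] in
/-- **BOUNDED AND ℂ-DIFFERENTIABLE ⇒ LIPSCHITZ ON A SMALLER BALL** (Cauchy's estimate for the derivative, then the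
mean-value inequality on the convex ball): `‖ψ‖ ≤ M` on `ball 0 R₂`, `ρ < R₂` ⟹
`‖ψ A − ψ A′‖ ≤ M∕(R₂ − ρ)·‖A − A′‖` for `A, A′ ∈ ball 0 ρ`. [folklore] -/
theorem norm_sub_le_of_ball_bound {ψ : (Λ → 𝔄) → F} {R₂ M ρ : ℝ} (hM : 0 ≤ M) (hρ : ρ < R₂)
    (hd : DifferentiableOn ℂ ψ (ball 0 R₂)) (hb : ∀ A ∈ ball (0 : Λ → 𝔄) R₂, ‖ψ A‖ ≤ M)
    {A A' : Λ → 𝔄} (hA : A ∈ ball (0 : Λ → 𝔄) ρ) (hA' : A' ∈ ball (0 : Λ → 𝔄) ρ) :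
    ‖ψ A - ψ A'‖ ≤ M / (R₂ - ρ) * ‖A - A'‖ := by
  have hsub : ball (0 : Λ → 𝔄) ρ ⊆ ball 0 R₂ := ball_subset_ball hρ.le
  have hD : ∀ A₁ ∈ ball (0 : Λ → 𝔄) ρ, ‖fderiv ℂ ψ A₁‖ ≤ M / (R₂ - ρ) := fun A₁ hA₁ => by
    have hA₁n : ‖A₁‖ < ρ := mem_ball_zero_iff.1 hA₁
    exact (norm_fderiv_le_of_norm_le hd hb (hA₁n.trans hρ)).trans
      (div_le_div_of_nonneg_left hM (by linarith) (by linarith))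
  have hf : ∀ A₁ ∈ ball (0 : Λ → 𝔄) ρ, HasFDerivWithinAt ψ (fderiv ℂ ψ A₁) (ball 0 ρ) A₁ := fun A₁ hA₁ =>
    ((hd.mono hsub).differentiableAt (isOpen_ball.mem_nhds hA₁)).hasFDerivAt.hasFDerivWithinAt
  exact (convex_ball (0 : Λ → 𝔄) ρ).norm_image_sub_le_of_norm_hasFDerivWithin_le hf hD hA' hA

/-- **LOCALITY PASSES TO THE DERIVATIVE**: a map blind to the bond `b` (`ψ (A + ι_b X) = ψ A` for all `A`, `X`) has
`Dψ(A + ι_b X) = Dψ(A)` — no differentiability proviso (`fderiv_comp_add_right`). [folklore] -/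
theorem fderiv_add_single_of_local {ψ : (Λ → 𝔄) → F} {S : Finset Λ}
    (hψ : ∀ A : Λ → 𝔄, ∀ b ∉ S, ∀ X : 𝔄, ψ (A + Pi.single b X) = ψ A) (A : Λ → 𝔄) {b : Λ} (hb : b ∉ S)
    (X : 𝔄) : fderiv ℂ ψ (A + Pi.single b X) = fderiv ℂ ψ A := by
  have h : fderiv ℂ (fun x => ψ (x + Pi.single b X)) A = fderiv ℂ ψ (A + Pi.single b X) :=
    fderiv_comp_add_right (f := ψ) (x := A) (Pi.single b X : Λ → 𝔄)
  have hfun : (fun x => ψ (x + Pi.single b X)) = ψ := funext fun A' => hψ A' b hb X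
  rw [hfun] at h
  exact h.symm

/-- **A LOCAL MAP HAS NO DERIVATIVE IN A BLIND SINGLE-BOND DIRECTION** (vector-valued form of S62 f1
`fderiv_comp_sgl_eq_zero`, no differentiability proviso: at a non-differentiable point `fderiv = 0`). [folklore] -/
theorem fderiv_comp_sgl_eq_zero_of_local {ψ : (Λ → 𝔄) → F} {S : Finset Λ}
    (hψ : ∀ A : Λ → 𝔄, ∀ b ∉ S, ∀ X : 𝔄, ψ (A + Pi.single b X) = ψ A) (A : Λ → 𝔄) {b : Λ} (hb : b ∉ S) :
    (fderiv ℂ ψ A).comp (sgl b) = 0 := by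
  by_cases hd : DifferentiableAt ℂ ψ A
  · have h1 : HasFDerivAt (fun X : 𝔄 => A + sgl b X) (sgl b : 𝔄 →L[ℂ] (Λ → 𝔄)) 0 :=
      ((sgl b : 𝔄 →L[ℂ] (Λ → 𝔄)).hasFDerivAt).const_add A
    have h2 : HasFDerivAt ψ (fderiv ℂ ψ A) (A + sgl b (0 : 𝔄)) := by
      rw [map_zero, add_zero]
      exact hd.hasFDerivAt
    have h3 : HasFDerivAt (fun X : 𝔄 => ψ (A + sgl b X)) ((fderiv ℂ ψ A).comp (sgl b)) 0 := h2.comp (0 : 𝔄) h1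
    have hconst : (fun X : 𝔄 => ψ (A + sgl b X)) = fun _ => ψ A := by
      funext X
      rw [sgl_apply]
      exact hψ A b hb X
    rw [hconst] at h3
    exact h3.unique (hasFDerivAt_const (ψ A) 0)
  · rw [fderiv_zero_of_not_differentiableAt hd, ContinuousLinearMap.zero_comp]

variable {φp : (Λ → 𝔄) → ℂ} {S : Finset Λ} {R M₀ : ℝ}

/-- The one-bond gradient `g_c(A) := Dφ_p(A) ∘ ι_c` of a functional local to `S` is itself local to `S`. [folklore] -/
theorem local_fderiv_comp_sgl (hloc : ∀ A : Λ → 𝔄, ∀ b ∉ S, ∀ X : 𝔄, φp (A + Pi.single b X) = φp A) (c : Λ) :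
    ∀ A : Λ → 𝔄, ∀ b ∉ S, ∀ X : 𝔄,
      (fderiv ℂ φp (A + Pi.single b X)).comp (sgl c) = (fderiv ℂ φp A).comp (sgl c) := fun A b hb X => by
  rw [fderiv_add_single_of_local hloc A hb X]

/-- The one-bond gradient `g_c` is analytic on the ball where `φ_p` is. [folklore] -/
theorem analyticOnNhd_fderiv_comp_sgl (ha : AnalyticOnNhd ℂ φp (ball 0 R)) (c : Λ) :
    AnalyticOnNhd ℂ (fun A : Λ → 𝔄 => (fderiv ℂ φp A).comp (sgl c)) (ball (0 : Λ → 𝔄) R) :=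
  ((ContinuousLinearMap.compL ℂ 𝔄 (Λ → 𝔄) ℂ).flip (sgl c)).comp_analyticOnNhd ha.fderiv

/-- The HESSIAN ENTRY `h_{c,b}(A) := D g_c(A) ∘ ι_b` is ℂ-differentiable on the ball where `φ_p` is analytic.
[folklore] -/
theorem differentiableOn_hessEntry (ha : AnalyticOnNhd ℂ φp (ball 0 R)) (c b : Λ) :
    DifferentiableOn ℂ
      (fun A : Λ → 𝔄 => (fderiv ℂ (fun A' : Λ → 𝔄 => (fderiv ℂ φp A').comp (sgl c)) A).comp (sgl b))
      (ball (0 : Λ → 𝔄) R) :=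
  (analyticOnNhd_fderiv_comp_sgl ha c).fderiv.differentiableOn.clm_comp (differentiableOn_const (sgl b))

/-- **THE HESSIAN ENTRY VANISHES OFF THE SUPPORT**: `h_{c,b}(A) = 0` for `b ∉ S` (locality of `g_c`). [folklore] -/
theorem hessEntry_eq_zero_of_not_mem (hloc : ∀ A : Λ → 𝔄, ∀ b ∉ S, ∀ X : 𝔄, φp (A + Pi.single b X) = φp A)
    (c : Λ) {b : Λ} (hb : b ∉ S) (A : Λ → 𝔄) :
    (fderiv ℂ (fun A' : Λ → 𝔄 => (fderiv ℂ φp A').comp (sgl c)) A).comp (sgl b) = 0 :=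
  fderiv_comp_sgl_eq_zero_of_local (local_fderiv_comp_sgl hloc c) A hb

/-- **THE ONE-BOND GRADIENT IS BOUNDED**: `‖g_c(A)‖ ≤ 4M₀∕R` on `ball 0 (3R∕4)` (`0 < R`, `‖φ_p‖ ≤ M₀` on `ball 0 R`).
[folklore] -/
theorem norm_fderiv_comp_sgl_le_threeQuarter (hR : 0 < R) (hM₀ : 0 ≤ M₀) (ha : AnalyticOnNhd ℂ φp (ball 0 R))
    (hM : ∀ A ∈ ball (0 : Λ → 𝔄) R, ‖φp A‖ ≤ M₀) (c : Λ) :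
    ∀ A ∈ ball (0 : Λ → 𝔄) (3 * R / 4), ‖(fderiv ℂ φp A).comp (sgl c)‖ ≤ 4 * M₀ / R := fun A hA => by
  have h := norm_fderiv_comp_sgl_le_of_lt hM₀ (by linarith : 3 * R / 4 < R) ha.differentiableOn hM c hA
  calc _ ≤ M₀ / (R - 3 * R / 4) := h
    _ = 4 * M₀ / R := by field_simp; ring

/-- **THE HESSIAN ENTRY IS BOUNDED**: `‖h_{c,b}(A)‖ ≤ 16M₀∕R²` on `ball 0 (R∕2)` (Cauchy twice). [folklore] -/
theorem norm_hessEntry_le (hR : 0 < R) (hM₀ : 0 ≤ M₀) (ha : AnalyticOnNhd ℂ φp (ball 0 R))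
    (hM : ∀ A ∈ ball (0 : Λ → 𝔄) R, ‖φp A‖ ≤ M₀) (c b : Λ) :
    ∀ A ∈ ball (0 : Λ → 𝔄) (R / 2),
      ‖(fderiv ℂ (fun A' : Λ → 𝔄 => (fderiv ℂ φp A').comp (sgl c)) A).comp (sgl b)‖ ≤ 16 * M₀ / R ^ 2 := by
  intro A hA
  have hsub : ball (0 : Λ → 𝔄) (3 * R / 4) ⊆ ball 0 R := ball_subset_ball (by linarith)
  have hd : DifferentiableOn ℂ (fun A' : Λ → 𝔄 => (fderiv ℂ φp A').comp (sgl c)) (ball 0 (3 * R / 4)) :=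
    ((analyticOnNhd_fderiv_comp_sgl ha c).mono hsub).differentiableOn
  have h := norm_fderiv_comp_sgl_le_of_lt (by positivity : (0 : ℝ) ≤ 4 * M₀ / R)
    (by linarith : R / 2 < 3 * R / 4) hd (norm_fderiv_comp_sgl_le_threeQuarter hR hM₀ ha hM c) b hA
  calc _ ≤ 4 * M₀ / R / (3 * R / 4 - R / 2) := h
    _ = 16 * M₀ / R ^ 2 := by field_simp; ring

/-- **THE HESSIAN ENTRY IS LIPSCHITZ**: `‖h_{c,b}(A) − h_{c,b}(A′)‖ ≤ (64M₀∕R³)·‖A − A′‖` for `A, A′ ∈ ball 0 (R∕4)` (Cauchy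
a third time, then the mean-value inequality on the convex ball). [folklore] -/
theorem norm_hessEntry_sub_le (hR : 0 < R) (hM₀ : 0 ≤ M₀) (ha : AnalyticOnNhd ℂ φp (ball 0 R))
    (hM : ∀ A ∈ ball (0 : Λ → 𝔄) R, ‖φp A‖ ≤ M₀) (c b : Λ) {A A' : Λ → 𝔄}
    (hA : A ∈ ball (0 : Λ → 𝔄) (R / 4)) (hA' : A' ∈ ball (0 : Λ → 𝔄) (R / 4)) :
    ‖(fderiv ℂ (fun A'' : Λ → 𝔄 => (fderiv ℂ φp A'').comp (sgl c)) A).comp (sgl b) -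
        (fderiv ℂ (fun A'' : Λ → 𝔄 => (fderiv ℂ φp A'').comp (sgl c)) A').comp (sgl b)‖ ≤
      64 * M₀ / R ^ 3 * ‖A - A'‖ := by
  have hsub2 : ball (0 : Λ → 𝔄) (R / 2) ⊆ ball 0 R := ball_subset_ball (by linarith)
  have h := norm_sub_le_of_ball_bound (ψ := fun A'' : Λ → 𝔄 =>
      (fderiv ℂ (fun A' : Λ → 𝔄 => (fderiv ℂ φp A').comp (sgl c)) A'').comp (sgl b))
    (by positivity : (0 : ℝ) ≤ 16 * M₀ / R ^ 2) (by linarith : R / 4 < R / 2)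
    ((differentiableOn_hessEntry ha c b).mono hsub2) (norm_hessEntry_le hR hM₀ ha hM c b) hA hA'
  calc _ ≤ 16 * M₀ / R ^ 2 / (R / 2 - R / 4) * ‖A - A'‖ := h
    _ = 64 * M₀ / R ^ 3 * ‖A - A'‖ := by
        congr 1
        field_simp
        ring

end OnePlaquette

end Summit.QuantumFields.BalabanUV.T4Continuum.ShellMeasureGradientPinnedLocal

end
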